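import Summits.BirchSwinnertonDyer.BirchSwinnertonDyer.Theorems.CongruentShaFreeCutPowerMapContraction
import HarnessLib

set_option linter.dupNamespace false -- `Summit.BirchSwinnertonDyer.BirchSwinnertonDyer.Theorems.…` (summit = sub)
set_option autoImplicit false

/-!
# Route `CongruentShaFreeCut` (rung S2) — LEMMA R∞, polynomial step: monic `Q₁, Q₂ ∈ ℂ_p[X]` with all
# roots in the open unit disc and `Q₂((1+X)^p−1) · Q₁^p = Q₂^p · Q₁((1+X)^p−1)` are EQUAL

Cell `bsd-cn100`, prover seat `bsd-cn100-transfer` (g11), plan g15 RULING-4 (2026-08-27T01:22:06Z)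
«COMMISSIONED … LEMMA R∞ (series rigidity across periods)», file 2 (pure polynomial algebra over `ℂ_p`), part 2.
Supports, does not close, stmt-BirchSwinnertonDyer-19079. THEOREMS ONLY; imports no `Theses` module and no
project file. PARTITION: none — RANK axis. HONEST FRAMING: elementary; nothing about BSD.

WHY. Two ♯-frames `𝓛, 𝓛'` of `IsBDPLFunctionUpTo` for the same `(ι, 𝔭, κ, γ, f)` satisfy the POWER-TYPE
functional equation `θ · 𝓛'(Φ) · 𝓛^p = 𝓛'^p · 𝓛(Φ)`, `Φ(X) = (1+X)^p − 1` (file 3); after `p`-content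
extraction and Weierstrass preparation in `R₀⟦T⟧` (file 1) its polynomial shadow is `P'(Φ)·P^p = P'^p·P(Φ)`
for the distinguished polynomials of `𝓛, 𝓛'` (roots in the open unit disc of `ℂ_p`). THIS FILE: that
identity forces `P = P'`. The purely algebraic statement is FALSE (`Q₁ = 1, Q₂ = (X+1)^n`; in characteristic
`p` every `Q`): the proof uses the `p`-adic CONTRACTION `‖(1+x)^p − 1‖ < ‖x‖` on the punctured open disc and
descends on a root of MINIMAL absolute value (shown to be a common root), after matching the multiplicities
of the root `0`. The LINEAR shape `P'·(P∘Φ) = P·(P'∘Φ)` of b2b-bsdres's cyclotomic tuple rigidity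
(`…Rank1Residual.Additive.eq_of_mul_comp_eq_mul_comp`) does not cover this power-type shape.

* §1 `normPowerMapEval_lt` — `‖(1+x)^p − 1‖ < ‖x‖` for `0 < ‖x‖ < 1` in `ℂ_p`.
* §2 `rootMultiplicity_zero_comp_powerMap` — the multiplicity of the root `0` is unchanged by `Q ↦ Q(Φ)`.
* §3 **`eq_of_comp_powerMap_mul_pow_eq`** — the rigidity statement.

References: [Washington1997] §7.1–7.2 (the `p`-power map on `Λ`); [Cassels1986] Ch. 4 (ultrametric
estimates).
-/

noncomputable section

open scoped Classical

open Polynomial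

namespace Summit.BirchSwinnertonDyer.BirchSwinnertonDyer.Theorems.CongruentShaFreeCutPowerMapPolynomialRigidity

variable {p : ℕ} [hp : Fact p.Prime]

/-! ### §3 The rigidity statement -/

/-- Dividing a monic polynomial by `X − α` at a root: the quotient is monic of degree one less, its roots
are roots of the original, and `Q = (X − α) · (Q / (X − α))`. [folklore] -/
theorem monic_div_X_sub_C {Q : ℂ_[p][X]} (hQ : Q.Monic) {α : ℂ_[p]} (h : Q.IsRoot α) :
    (Q / (X - C α)).Monic ∧ (Q / (X - C α)).natDegree + 1 = Q.natDegree ∧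
      (∀ β, (Q / (X - C α)).IsRoot β → Q.IsRoot β) ∧ Q = (X - C α) * (Q / (X - C α)) := by
  have hfac : (X - C α) * (Q / (X - C α)) = Q := (mul_div_eq_iff_isRoot).mpr h
  have hne : Q / (X - C α) ≠ 0 := by
    intro h0
    rw [h0, mul_zero] at hfac
    exact hQ.ne_zero hfac.symm
  refine ⟨?_, ?_, ?_, hfac.symm⟩
  · have hm : ((X - C α) * (Q / (X - C α))).Monic := by rw [hfac]; exact hQ
    exact (monic_X_sub_C α).of_mul_monic_left hm
  · have hdeg := congrArg natDegree hfac
    rw [natDegree_mul (X_sub_C_ne_zero α) hne, natDegree_X_sub_C] at hdeg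
    omega
  · intro β hβ
    rw [← hfac]
    exact (root_mul).mpr (Or.inr hβ)

/-- **Polynomial rigidity of the power-type functional equation.** `Φ = (1+X)^p − 1 ∈ ℂ_p[X]`; `Q₁, Q₂`
MONIC with ALL ROOTS IN THE OPEN UNIT DISC; `Q₂(Φ)·Q₁^p = Q₂^p·Q₁(Φ)` ⟹ `Q₁ = Q₂`. Induction on
`deg Q₁ + deg Q₂`: equal multiplicity of the root `0` (`rootMultiplicity_zero_eq_of_identity`) — divide by `X`;
else a root `α₀ ≠ 0` of `Q₁Q₂` of MINIMAL absolute value is COMMON (evaluate at `α₀`; a root `Φ(α₀)` would be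
smaller, `normPowerMapEval_lt`) — divide by `X − α₀`; base `Q₁ = 1`: `Q₂(Φ) = Q₂^p` is impossible in positive
degree. False without the disc hypothesis (`Q₂ = (X+1)^n`). [cite: Washington1997, §7.2 (the p-power map T ↦ (1+T)^p − 1)] -/
theorem eq_of_comp_powerMap_mul_pow_eq {Q₁ Q₂ : ℂ_[p][X]} (h₁ : Q₁.Monic) (h₂ : Q₂.Monic)
    (hr₁ : ∀ α, Q₁.IsRoot α → ‖α‖ < 1) (hr₂ : ∀ α, Q₂.IsRoot α → ‖α‖ < 1)
    (hid : Q₂.comp ((1 + X : ℂ_[p][X]) ^ p - 1) * Q₁ ^ p =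
      Q₂ ^ p * Q₁.comp ((1 + X : ℂ_[p][X]) ^ p - 1)) : Q₁ = Q₂ := by
  set Φ : ℂ_[p][X] := (1 + X : ℂ_[p][X]) ^ p - 1 with hΦdef
  have hp1 : p ≠ 0 := hp.out.ne_zero
  have hΦ0 : Φ.eval 0 = 0 := by simp [hΦdef]
  have hΦne : Φ ≠ 0 := powerMap_ne_zero
  -- the statement, quantified for the induction
  suffices H : ∀ n : ℕ, ∀ Q₁ Q₂ : ℂ_[p][X], Q₁.natDegree + Q₂.natDegree = n → Q₁.Monic → Q₂.Monic →
      (∀ α, Q₁.IsRoot α → ‖α‖ < 1) → (∀ α, Q₂.IsRoot α → ‖α‖ < 1) →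
      Q₂.comp Φ * Q₁ ^ p = Q₂ ^ p * Q₁.comp Φ → Q₁ = Q₂ from H _ Q₁ Q₂ rfl h₁ h₂ hr₁ hr₂ hid
  intro n
  induction n using Nat.strong_induction_on with
  | _ n ih =>
  intro Q₁ Q₂ hn h₁ h₂ hr₁ hr₂ hid
  have hQ₁ := h₁.ne_zero
  have hQ₂ := h₂.ne_zero
  have hrm : rootMultiplicity 0 Q₁ = rootMultiplicity 0 Q₂ :=
    rootMultiplicity_zero_eq_of_identity hQ₁ hQ₂ hid
  -- the symmetric «evaluate at a minimal root» step, used twice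
  have hsymm : Q₁.comp Φ * Q₂ ^ p = Q₁ ^ p * Q₂.comp Φ := by rw [mul_comm, ← hid, mul_comm]
  -- Case 1: both constant
  by_cases hdeg : Q₁.natDegree = 0 ∧ Q₂.natDegree = 0
  · rw [eq_one_of_monic_natDegree_zero h₁ hdeg.1, eq_one_of_monic_natDegree_zero h₂ hdeg.2]
  -- Case 2: `0` is a root of `Q₁` (hence of `Q₂`): divide by `X`
  by_cases hz : Q₁.IsRoot 0
  · have hz₂ : Q₂.IsRoot 0 := by
      have h0 : 0 < rootMultiplicity 0 Q₁ := (rootMultiplicity_pos hQ₁).mpr hz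
      rw [hrm] at h0
      exact ((rootMultiplicity_pos hQ₂).mp h0)
    obtain ⟨hm₁, hd₁, hroot₁, hfac₁⟩ := monic_div_X_sub_C h₁ hz
    obtain ⟨hm₂, hd₂, hroot₂, hfac₂⟩ := monic_div_X_sub_C h₂ hz₂
    rw [map_zero, sub_zero] at hm₁ hd₁ hroot₁ hfac₁ hm₂ hd₂ hroot₂ hfac₂
    set R₁ := Q₁ / X
    set R₂ := Q₂ / X
    have hid' : R₂.comp Φ * R₁ ^ p = R₂ ^ p * R₁.comp Φ := by
      have e1 : Q₂.comp Φ * Q₁ ^ p = (Φ * X ^ p) * (R₂.comp Φ * R₁ ^ p) := by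
        rw [hfac₂, hfac₁, mul_comp, X_comp, mul_pow]; ring
      have e2 : Q₂ ^ p * Q₁.comp Φ = (Φ * X ^ p) * (R₂ ^ p * R₁.comp Φ) := by
        rw [hfac₂, hfac₁, mul_comp, X_comp, mul_pow]; ring
      rw [e1, e2] at hid
      exact mul_left_cancel₀ (mul_ne_zero hΦne (pow_ne_zero _ X_ne_zero)) hid
    have hlt : R₁.natDegree + R₂.natDegree < n := by omega
    have := ih _ hlt R₁ R₂ rfl hm₁ hm₂ (fun α hα ↦ hr₁ α (hroot₁ α hα))
      (fun α hα ↦ hr₂ α (hroot₂ α hα)) hid'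
    rw [hfac₁, hfac₂, this]
  -- Case 3: `0` is not a root of `Q₁`, nor of `Q₂`; a minimal root is a common root
  have hz₂ : ¬ Q₂.IsRoot 0 := by
    intro h
    have h0 : 0 < rootMultiplicity 0 Q₂ := (rootMultiplicity_pos hQ₂).mpr h
    rw [← hrm] at h0
    exact hz ((rootMultiplicity_pos hQ₁).mp h0)
  have hprod_ne : Q₁ * Q₂ ≠ 0 := mul_ne_zero hQ₁ hQ₂
  have hroots_ne : (Q₁ * Q₂).roots.toFinset.Nonempty := by
    have hnd : 0 < (Q₁ * Q₂).natDegree := by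
      rw [Polynomial.Monic.natDegree_mul h₁ h₂]; omega
    have hdeg0 : (Q₁ * Q₂).degree ≠ 0 := by
      rw [degree_eq_natDegree hprod_ne]; exact_mod_cast hnd.ne'
    obtain ⟨α, hα⟩ := IsAlgClosed.exists_root (Q₁ * Q₂) hdeg0
    exact ⟨α, Multiset.mem_toFinset.mpr ((mem_roots hprod_ne).mpr hα)⟩
  obtain ⟨α₀, hα₀mem, hmin⟩ := (Q₁ * Q₂).roots.toFinset.exists_min_image (fun a ↦ ‖a‖) hroots_ne
  have hα₀root : (Q₁ * Q₂).IsRoot α₀ := (mem_roots hprod_ne).mp (Multiset.mem_toFinset.mp hα₀mem)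
  have hmin' : ∀ β, (Q₁ * Q₂).IsRoot β → ‖α₀‖ ≤ ‖β‖ :=
    fun β hβ ↦ hmin β (Multiset.mem_toFinset.mpr ((mem_roots hprod_ne).mpr hβ))
  have hα₀ne : α₀ ≠ 0 := by
    rintro rfl
    rcases root_mul.mp hα₀root with h | h
    · exact hz h
    · exact hz₂ h
  have hα₀lt : ‖α₀‖ < 1 := by
    rcases root_mul.mp hα₀root with h | h
    · exact hr₁ α₀ h
    · exact hr₂ α₀ h
  have hcontr : ‖Φ.eval α₀‖ < ‖α₀‖ := normPowerMapEval_lt hα₀ne hα₀lt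
  -- evaluation of the identity at `α₀`
  have hev : Q₂.eval (Φ.eval α₀) * (Q₁.eval α₀) ^ p = (Q₂.eval α₀) ^ p * Q₁.eval (Φ.eval α₀) := by
    have := congrArg (eval α₀) hid
    simpa only [eval_mul, eval_pow, eval_comp] using this
  have hcommon : Q₁.IsRoot α₀ ∧ Q₂.IsRoot α₀ := by
    rcases root_mul.mp hα₀root with h | h
    · refine ⟨h, ?_⟩
      rw [IsRoot.def] at h
      rw [h, zero_pow hp1, mul_zero] at hev
      rcases mul_eq_zero.mp hev.symm with h' | h'
      · exact (pow_eq_zero_iff hp1).mp h'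
      · exfalso
        have hβ : (Q₁ * Q₂).IsRoot (Φ.eval α₀) := root_mul.mpr (Or.inl h')
        exact (hmin' _ hβ).not_gt hcontr
    · refine ⟨?_, h⟩
      rw [IsRoot.def] at h
      rw [h, zero_pow hp1, zero_mul] at hev
      rcases mul_eq_zero.mp hev with h' | h'
      · exfalso
        have hβ : (Q₁ * Q₂).IsRoot (Φ.eval α₀) := root_mul.mpr (Or.inr h')
        exact (hmin' _ hβ).not_gt hcontr
      · exact (pow_eq_zero_iff hp1).mp h'
  obtain ⟨hm₁, hd₁, hroot₁, hfac₁⟩ := monic_div_X_sub_C h₁ hcommon.1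
  obtain ⟨hm₂, hd₂, hroot₂, hfac₂⟩ := monic_div_X_sub_C h₂ hcommon.2
  set R₁ := Q₁ / (X - C α₀)
  set R₂ := Q₂ / (X - C α₀)
  have hid' : R₂.comp Φ * R₁ ^ p = R₂ ^ p * R₁.comp Φ := by
    have e1 : Q₂.comp Φ * Q₁ ^ p = ((Φ - C α₀) * (X - C α₀) ^ p) * (R₂.comp Φ * R₁ ^ p) := by
      rw [hfac₂, hfac₁, mul_comp, sub_comp, X_comp, C_comp, mul_pow]; ring
    have e2 : Q₂ ^ p * Q₁.comp Φ = ((Φ - C α₀) * (X - C α₀) ^ p) * (R₂ ^ p * R₁.comp Φ) := by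
      rw [hfac₂, hfac₁, mul_comp, sub_comp, X_comp, C_comp, mul_pow]; ring
    rw [e1, e2] at hid
    refine mul_left_cancel₀ (mul_ne_zero ?_ (pow_ne_zero _ (X_sub_C_ne_zero α₀))) hid
    intro h0
    exact powerMap_ne_C α₀ (sub_eq_zero.mp h0)
  have hlt : R₁.natDegree + R₂.natDegree < n := by omega
  have := ih _ hlt R₁ R₂ rfl hm₁ hm₂ (fun α hα ↦ hr₁ α (hroot₁ α hα))
    (fun α hα ↦ hr₂ α (hroot₂ α hα)) hid'
  rw [hfac₁, hfac₂, this]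

end Summit.BirchSwinnertonDyer.BirchSwinnertonDyer.Theorems.CongruentShaFreeCutPowerMapPolynomialRigidity

end
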